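import Summits.HodgeConjecture.HodgeConjecture.Theorems.WeilTypeLadderTwistedSquares
import Literature.AlgebraicGeometry.HodgeTheory.WeilClassesSplitSquare
import HarnessLib

/-!
# Weil-type ladder — DELIGNE'S SPLIT SQUARES `(T × T, Φ_d)`: the rungs R1, R2₈, R2, R∞ hold UNCONDITIONALLY on the loci `{T × T : T ∈ 𝒜_g}`

B2b ladder `hodge-weil` (HOME `run/shared/lean/b2b/hodge-weil/`, CENSUS ## P3-g4), prover 3 generation 4
(strategy: special cases with CLASSICAL tools). Helper of the route item `WeilSixfolds` (R1,
stmt-HodgeConjecture-2524). No `sorry`, no definition, NO NAMED FACT: everything rests on the tree's PROVED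
theorem `Literature.AlgebraicGeometry.HodgeTheory.weilClassesOf_splitSquare_le_algebraicClasses`
(`HodgeTheory/WeilClassesSplitSquare`, p178590 — Deligne, LNM 900 (1982) §4 Lemma 4.5 / Remark 4.10 on
the carriers): for EVERY complex abelian variety `T` of dimension `g ≥ 1` and every `d ≥ 1`, the
abelian `2g`-fold `A₀ ⊗ K = (T × T, Φ_d)`, `Φ_d(x, y) = (-d·y, x)` (`K = ℚ(√-d)` acting on the multiplicity
space; `Φ_d ≫ Φ_d = -d`; NO endomorphism of `T` is needed), has algebraic Weil classes.

## What is typed here (all unconditional)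

* R2₈ = `SplitEightfolds` at the EIGHTFOLDS `(X × X, Φ_d)`, `X` ANY abelian fourfold:
  `splitEightfolds_body_splitSquare` — a `10`-dimensional locus (`X ∈ 𝒜₄`) inside the `16`-dimensional
  split (`δ = +1`) eightfold components, every `K` ("dim `≥ 8`: nothing for any `K`" for the GENERAL member,
  arXiv:2502.03415 §1.2; known loci so far: products `X⁴ × Y⁴` mod F1 / Markman 2023, `A⁶ × S²` mod F2,
  Schoen's cyclic Pryms mod the refereed fact at `d = 3`, twisted squares `X × X̄` and `(T × T̄) × S`
  (fact-free, `Theorems/WeilTypeLadderTwistedSquares`), CM points mod Aoki);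
* R2 = `SplitWeilAbelianVarieties` at `(T × T, Φ_d)`, `dim T = n ≥ 4`: `splitWeilAbelianVarieties_body_splitSquare`
  (an `n(n+1)/2`-dimensional locus in the split components, every `n`, every `K`);
* R1 = `WeilSixfolds` (stmt-2524) at `(T × T, Φ_d)`, `T` a threefold: `weilSixfolds_body_splitSquare`
  (`6`-dimensional, inside the SPLIT sixfold component `δ = -1` = the floor F0a's domain, which is refereed
  only at `d ∈ {1, 3}`; here fact-free for every `d`), with its isogeny-closed form;
* ON-PATH: `HodgeConjecture ⟹` each.

DISCRIMINANT (pen-and-paper; not on the carriers): for a polarization `L` of `T` with alternating form `E`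
and a Lagrangian `Λ ⊂ H₁(T, ℚ)`, the `K`-subspace `Λ ⊗ K ⊂ H₁(T, ℚ) ⊗ K = H₁(T × T, ℚ)` is isotropic for
van Geemen's form of the `K`-compatible polarization `L ⊠ d·L` of `(T × T, Φ_d)`, of `K`-dimension
`g = ½ dim_K`: HYPERBOLIC, discriminant `(-1)^g`, i.e. these loci lie in the SPLIT components (Deligne's
Theorem 4.8 is about split Weil type precisely because every split family contains an `A₀ ⊗ K`).

Honest framing: special loci (`T × T` for ARBITRARY `T`), not general members; Weil classes there are
classes of the coordinate abelian subvarieties (Deligne Rem. 4.10), not exceptional; unconditional RUNGS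
above the floor added: 0; unconditional kernel-checked LOCI on R2₈ / R2: yes (`dim 10` of `16` for
eightfolds).
-/

noncomputable section

-- every declaration of this problem lives in Summit.HodgeConjecture.HodgeConjecture.… (summit = sub-problem)
set_option linter.dupNamespace false

open CategoryTheory
open Literature.AlgebraicGeometry Literature.AlgebraicGeometry.Motives
open Literature.AlgebraicGeometry.HodgeTheory
open Literature.AlgebraicTopology.SingularHomology

namespace Summit.HodgeConjecture.HodgeConjecture.WeilTypeLadder

/-! ### Eightfolds `(X × X, Φ_d)`, `X` any abelian fourfold: R2₈ -/

section Eightfolds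

variable {X : AbelianVariety ℂ} {d : ℕ}

/-- **Rung R2₈ (`SplitEightfolds`) AT Deligne's split squares of abelian FOURFOLDS — UNCONDITIONAL**: for
every complex abelian fourfold `X` and every `d ≥ 1`, every rational `(4,4)`-class of the Weil plane of
the eightfold `(X × X, Φ_d)` is algebraic (R2₈'s body at `A = X × X`, `φ = Φ_d`, with its hyperbolicity
hypothesis dropped — it holds: module docstring). A `10`-dimensional fact-free locus in the `16`-dimensional
split eightfold components, for every `K = ℚ(√-d)`. [cite: Deligne1982HodgeCycles, §4 Lemma 4.5 and Remark 4.10]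
[cite: Markman2025SecantWeil, §1.2] -/
theorem splitEightfolds_body_splitSquare (hX : X.dim = 4) (hd : 0 < d) :
    ∀ c : complexBetti (X.prod X).X (2 * 4), IsRationalClass c →
      IsOfHodgeType (2 * 4) (X.prod X).X (2 * 4) 4 4 c →
        c ∈ weilClassesOf (X.prod X)
          (AbelianVariety.prodLift (AbelianVariety.snd X X ≫ (-(d • 𝟙 X))) (AbelianVariety.fst X X)) 4 d →
          c ∈ algebraicClasses (X.prod X).X 4 :=
  mem_algebraicClasses_of_mem_weilClassesOf_splitSquare (by norm_num) hX hd

/-- R2₈'s body VERBATIM (hyperbolicity hypothesis carried, unused) at `(X × X, Φ_d)`. -/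
theorem splitEightfolds_body_splitSquare' (hX : X.dim = 4) :
    ∀ (d : ℕ), 0 < d → (X.prod X).dim = 2 * 4 → Motives.IsSmoothProjective (2 * 4) (X.prod X).X →
      AbelianVariety.prodLift (AbelianVariety.snd X X ≫ (-(d • 𝟙 X))) (AbelianVariety.fst X X) ≫
          AbelianVariety.prodLift (AbelianVariety.snd X X ≫ (-(d • 𝟙 X))) (AbelianVariety.fst X X) =
        -(d • 𝟙 (X.prod X)) →
      ∀ (e : Motives.ProjectiveEmbedding (X.prod X).X)
        (a : complexBetti (Motives.projectiveSpace e.n ℂ) 2), IsRationalClass a → a ≠ 0 →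
        Motives.IsHyperbolicWeilType (X.prod X)
          (AbelianVariety.prodLift (AbelianVariety.snd X X ≫ (-(d • 𝟙 X))) (AbelianVariety.fst X X)) 4
          ((d : ℂ) • complexBetti.map e.ι 2 a +
            complexBetti.map (AbelianVariety.prodLift (AbelianVariety.snd X X ≫ (-(d • 𝟙 X)))
              (AbelianVariety.fst X X)).hom.hom.hom 2 (complexBetti.map e.ι 2 a)) →
          ∀ c : complexBetti (X.prod X).X (2 * 4), IsRationalClass c →
            IsOfHodgeType (2 * 4) (X.prod X).X (2 * 4) 4 4 c →
              c ∈ weilClassesOf (X.prod X)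
                (AbelianVariety.prodLift (AbelianVariety.snd X X ≫ (-(d • 𝟙 X))) (AbelianVariety.fst X X)) 4 d →
              c ∈ algebraicClasses (X.prod X).X 4 :=
  fun _ hd _ _ _ _ _ _ _ _ ↦ splitEightfolds_body_splitSquare hX hd

/-- ON-PATH (eightfolds): `HodgeConjecture` ⟹ the statement, via R∞ at `n = 4`. -/
theorem splitEightfolds_body_splitSquare_of_hodgeConjecture (h : _root_.HodgeConjecture) (hX : X.dim = 4)
    (hd : 0 < d) :
    ∀ c : complexBetti (X.prod X).X (2 * 4), IsRationalClass c →
      IsOfHodgeType (2 * 4) (X.prod X).X (2 * 4) 4 4 c →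
        c ∈ weilClassesOf (X.prod X)
          (AbelianVariety.prodLift (AbelianVariety.snd X X ≫ (-(d • 𝟙 X))) (AbelianVariety.fst X X)) 4 d →
          c ∈ algebraicClasses (X.prod X).X 4 :=
  have hdim : (X.prod X).dim = 2 * 4 := dim_twistedSquare hX
  weilClassesImaginaryQuadratic_of_hodgeConjecture h 4 (by norm_num) d hd (X.prod X) _ hdim
    (Motives.isSmoothProjective_of_dim_eq' hdim) splitSquare_comp_self

end Eightfolds

/-! ### All `n ≥ 4`: R2 (split `2n`-folds) and R∞ -/

section AllDimensions

variable {T : AbelianVariety ℂ} {n d : ℕ}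

/-- **Rungs R2 (`SplitWeilAbelianVarieties`) / R∞ AT Deligne's split squares — UNCONDITIONAL**: for every
`n ≥ 1`, every complex abelian `n`-fold `T` and every `d ≥ 1`, every rational `(n,n)`-class of the Weil plane
of `(T × T, Φ_d)` is algebraic (an `n(n+1)/2`-dimensional locus of split Weil `2n`-folds, every `K`).
[cite: Deligne1982HodgeCycles, §4 Lemma 4.5 and Remark 4.10] -/
theorem splitWeilAbelianVarieties_body_splitSquare (hn : 0 < n) (hT : T.dim = n) (hd : 0 < d) :
    ∀ c : complexBetti (T.prod T).X (2 * n), IsRationalClass c →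
      IsOfHodgeType (2 * n) (T.prod T).X (2 * n) n n c →
        c ∈ weilClassesOf (T.prod T)
          (AbelianVariety.prodLift (AbelianVariety.snd T T ≫ (-(d • 𝟙 T))) (AbelianVariety.fst T T)) n d →
          c ∈ algebraicClasses (T.prod T).X n :=
  mem_algebraicClasses_of_mem_weilClassesOf_splitSquare hn hT hd

/-- ON-PATH: `HodgeConjecture` ⟹ the statement at every split square (`n ≥ 2`). -/
theorem splitWeilAbelianVarieties_body_splitSquare_of_hodgeConjecture (h : _root_.HodgeConjecture)
    (hn : 2 ≤ n) (hT : T.dim = n) (hd : 0 < d) :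
    ∀ c : complexBetti (T.prod T).X (2 * n), IsRationalClass c →
      IsOfHodgeType (2 * n) (T.prod T).X (2 * n) n n c →
        c ∈ weilClassesOf (T.prod T)
          (AbelianVariety.prodLift (AbelianVariety.snd T T ≫ (-(d • 𝟙 T))) (AbelianVariety.fst T T)) n d →
          c ∈ algebraicClasses (T.prod T).X n :=
  have hdim : (T.prod T).dim = 2 * n := dim_twistedSquare hT
  weilClassesImaginaryQuadratic_of_hodgeConjecture h n hn d hd (T.prod T) _ hdim
    (Motives.isSmoothProjective_of_dim_eq' hdim) splitSquare_comp_self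

end AllDimensions

/-! ### Sixfolds `(T × T, Φ_d)`, `T` a threefold: R1 (split component) -/

section Sixfolds

variable {T : AbelianVariety ℂ} {d : ℕ}

/-- **Rung R1 (`WeilSixfolds`, stmt-2524) AT Deligne's split squares of THREEFOLDS — UNCONDITIONAL**: for
every complex abelian threefold `T` and `d ≥ 1`, every rational `(3,3)`-class of the Weil plane of
`(T × T, Φ_d)` is algebraic — a `6`-dimensional fact-free locus in the split sixfold component `(K, 3, -1)`
(the floor F0a's domain, refereed only at `d ∈ {1,3}`). [cite: Deligne1982HodgeCycles, §4 Remark 4.10] -/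
theorem weilSixfolds_body_splitSquare (hT : T.dim = 3) (hd : 0 < d) :
    ∀ c : complexBetti (T.prod T).X (2 * 3), IsRationalClass c →
      IsOfHodgeType (2 * 3) (T.prod T).X (2 * 3) 3 3 c →
        c ∈ weilClassesOf (T.prod T)
          (AbelianVariety.prodLift (AbelianVariety.snd T T ≫ (-(d • 𝟙 T))) (AbelianVariety.fst T T)) 3 d →
          c ∈ algebraicClasses (T.prod T).X 3 :=
  mem_algebraicClasses_of_mem_weilClassesOf_splitSquare (by norm_num) hT hd

/-- **Isogeny-closed form** (sixfolds `K`-isogenous to a split square of a threefold): body of R1 at every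
`(A, φ_A)` with a `K`-equivariant isogeny pair towards `(T × T, Φ_d)` — UNCONDITIONAL.
[cite: Markman2025SurveySecant, §11.5 Step 1] -/
theorem weilSixfolds_body_of_isogeny_splitSquare (hT : T.dim = 3) (hd : 0 < d) {A : AbelianVariety ℂ}
    {φA : A ⟶ A} (hA : A.dim = 2 * 3) (MB : HodgeModel (2 * 3) (T.prod T).X) (f : A ⟶ T.prod T)
    (g : T.prod T ⟶ A) [AlgebraicGeometry.Flat f.hom.hom.hom.left]
    (hg : g ≫ φA =
      AbelianVariety.prodLift (AbelianVariety.snd T T ≫ (-(d • 𝟙 T))) (AbelianVariety.fst T T) ≫ g)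
    {m : ℕ} (hm : 0 < m) (hfg : f ≫ g = m • 𝟙 A) :
    ∀ c : complexBetti A.X (2 * 3), IsRationalClass c → IsOfHodgeType (2 * 3) A.X (2 * 3) 3 3 c →
      c ∈ weilClassesOf A φA 3 d → c ∈ algebraicClasses A.X 3 :=
  fun _ hc hcH hcW ↦
    mem_algebraicClasses_of_isogeny_of_mem_weilClassesOf (Motives.isSmoothProjective_of_dim_eq' hA)
      (Motives.isSmoothProjective_of_dim_eq' (dim_twistedSquare hT)) MB f g hg hm hfg
      (weilSixfolds_body_splitSquare hT hd) hc hcH hcW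

/-- ON-PATH (sixfolds): `HodgeConjecture` ⟹ the statement, via R∞ at `n = 3`. -/
theorem weilSixfolds_body_splitSquare_of_hodgeConjecture (h : _root_.HodgeConjecture) (hT : T.dim = 3)
    (hd : 0 < d) :
    ∀ c : complexBetti (T.prod T).X (2 * 3), IsRationalClass c →
      IsOfHodgeType (2 * 3) (T.prod T).X (2 * 3) 3 3 c →
        c ∈ weilClassesOf (T.prod T)
          (AbelianVariety.prodLift (AbelianVariety.snd T T ≫ (-(d • 𝟙 T))) (AbelianVariety.fst T T)) 3 d →
          c ∈ algebraicClasses (T.prod T).X 3 :=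
  splitWeilAbelianVarieties_body_splitSquare_of_hodgeConjecture h (by norm_num) hT hd

end Sixfolds

end Summit.HodgeConjecture.HodgeConjecture.WeilTypeLadder

end
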